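import Summits.AtomisticToContinuum.HydrodynamicLimit.Theorems.SpeedCapSurgeryCappedEulerLimitMeso
import Summits.AtomisticToContinuum.HydrodynamicLimit.Theorems.SpeedCapSurgeryCappedEulerLimitDominated
import HarnessLib

/-!
# Line `registered` (LEAD COPY, v3 — lead cycle 2) for crux `CappedEulerLimit` —
# item stmt-AtomisticToContinuum-17739, route `SpeedCapSurgery` (rank 3, crux (U)), sub-problem `HydrodynamicLimit`

Lead's reshape log:
* cycle 1 (prover-line-stmt-AtomisticToContinuum-17739-0) — namespace `…Theorems.CappedEulerLimit`; `stub_reference` (p150193),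
  `stub_timeZero` (p151266), `stub_cappedKlDivNeTop` (p153020), `stub_cappedKlDivZero` (p153408) LANDED; the birth stub
  `stub_cappedGronwall` became the theorem `cappedEntropyPropagation_of_windowStep` (part I, p154289) over the residual stub
  `stub_cappedWindowStep : ∃ ηw > 0, CappedWindowEntropyStepBelow ηw`; part II `CappedEulerLimit_of_cappedWindowStep` (p154512).
  Outcome: promote-stub (the residue is crux-sized: deterministic one-block with a rate).
* cycle 2 (continuation lead prover-line-stmt-AtomisticToContinuum-17739-c1-0), THIS VERSION:
  - RESHAPE of the residue's SHAPE (part IV `Theorems/SpeedCapSurgeryCappedEulerLimitMeso.lean`, p156887): the cycle-1 residue asked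
    the window inequality for ALL sub-windows `0 < w' ≤ w_N`, i.e. an INSTANTANEOUS entropy-production bound
    `D⁺H_N ≤ K M_N H_N + (N+1)^{1-a}` — more than the Nachtergaele–Yau / OVY mechanism delivers (one-block replacement is a
    statement about time averages over MESOSCOPIC windows `w_N ≍ τ(N+1)^{-1/3}`; below that scale only the static entropy
    inequality is available, error `O(√(N·H))`, not of the required shape for `(N+1)^{1-2a} ≲ H ≲ N/log N`). The residue is now
    `stub_cappedWindowStepMeso : ∃ ηw > 0, CappedWindowEntropyStepMesoBelow ηw` — SAME inequality, windows of length
    `w_N ≤ w' ≤ 2w_N` only, `w_N → 0`; the old residue implies the new one (`windowStepMeso_of_windowStep`), the glue is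
    re-proved along ONE chain of windows started at `0` (`chain_window_gronwall`, no start-up / window-continuity clause), and
    `CappedEulerLimit_of_cappedWindowStepMeso` closes the crux from it.
  - DOMINANCE recorded (part III `Theorems/SpeedCapSurgeryCappedEulerLimitDominated.lean`, p156843): `H_cap(t) ≤ H_full(t) + 1`
    for every cap (`klDiv_lawAt_restrict_le`; `KL(μ‖ν) ≤ KL(μ'‖ν) + ν(univ)` for `μ ≤ μ'`), `cappedEntropyPropagation_of_uncapped`,
    `conjunctImpliesCapped_proof : Theses.SpeedCapSurgery.ConjunctImpliesCapped` (support item 9636's statement),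
    `CappedEulerLimit_of_hydroLimitInBand` (crux 9133 ⟹ U), `CappedEulerLimit_of_relEntropyVanishingInBand` (target 17396 ⟹ U),
    `CappedEulerLimit_of_signedInputs` (SEET ∧ KCWF-Q ∧ LCT ∧ EAT ∧ CAT ⟹ U, via the landed v16 binder of line HydroLimitInBand).
    So U is closed by ANY closure of the conjunct's entropy target; the capped line earns only through its METHOD (rates on the cap).

Crux BY NAME: `Summit.AtomisticToContinuum.HydrodynamicLimit.Theses.SpeedCapSurgery.CappedEulerLimit`
(∃ η₀ > 0 ∀ continuous positive profiles ∃ σ₀ ∀ 0 < σ < σ₀ ∀ classical hs-Euler solutions IN THE PACKING BAND `ρ_t σ³ < η₀`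
∀ flow families `Φ_N` with the local-Gibbs LLN at `t = 0` ∀ t ∈ [0,T) ∀ C: `TendstoHydroFieldsAt` at time `t` for the initial
local Gibbs laws RESTRICTED to the cap event `{z | ∀ r ∈ [0,t], ∀ i, |v_i(Φ_N(r) z)| ≤ C√log(N+2)}`).

THE LINE (unchanged composition idea): Yau 1991 / Olla–Varadhan–Yau 1993 §3–5 run for the DETERMINISTIC hard-sphere flow on `𝕋³`,
in the band, for the CAPPED initial law `λ_N|cap` pushed forward by the flow, against the EXPLICIT local Gibbs reference built on
the Euler solution with the thermodynamic activity `thermoActivity σ (ρ t)`; statics (`stub_reference`), time zero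
(`stub_timeZero`), finiteness / time-zero entropy (`stub_cappedKlDivNeTop`, `stub_cappedKlDivZero`) LANDED; chain Gronwall + rate
arithmetic + entropy inequality for the capped laws PROVED (parts I, II, IV); ONE research residue (below).

## Disproof used
Still no `Cruxes/CappedEulerLimit/Disproof.lean` and no `Theorems/CappedEulerLimit/Negative/*` (`ledger crux ls`, 2026-08-17T11:40Z).
Refuter vetting (ATTACK.md/Evidence.lean, 06:13Z): every degenerate corner TRUE (C ≤ 0, t = 0, T ≤ 0, equilibrium slice); eread
(10:14Z): `MaxSpeedBoundLog → (CappedEulerLimit ↔ HydrodynamicLimit)`. Consistent with part III: U cannot be false unless the summit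
conjunct is (¬U ⇒ ¬HydrodynamicLimit, `conjunctImpliesCapped_proof`).

## Barriers
`HighMomentumCutoffBarrier(Narrow)` — met as the route records: the cubic current is truncated EXACTLY on the cap event, price
`e^{K·C√log(N+2)·t} = N^{o(1)}` paid by RATES inside the residue; `BoltzmannHypothesisBarrier(Narrow)` / `MacroErgodicityBarrier` —
not evaded: the quantitative one-block step for the deterministic capped dynamics IS the residue (now on mesoscopic windows, the
honest form); `ShockFormation` — per classical solution on `[0,T)`. NEW (cycle 2): at FIXED thresholds the cap discharges none of
the sibling dock's true-law a-priori inputs (SEET 17701, EAT 17703, CAT 13734); it can only trade them for REFERENCE-law exp-moment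
inputs WITH RATES and polylog(N) class constants ("KCWF-R", "LCT-R", window collision-count exp moments) — not filed anywhere.
-/

noncomputable section

namespace Summit.AtomisticToContinuum.HydrodynamicLimit.Theorems.CappedEulerLimit

open scoped ENNReal NNReal Topology
open MeasureTheory Filter Set InformationTheory
open Literature.Analysis.FluidPDE
open Literature.MathematicalPhysics.KineticTheory
open Summit.AtomisticToContinuum.HydrodynamicLimit.Theses.SpeedCapSurgery
open Summit.AtomisticToContinuum.HydrodynamicLimit.Theorems.KineticWindowGronwallActivityInversion

/-! ## The single open stub (re-typed residue, v3) -/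

/-- **Stub 3a′ — THE CAPPED WINDOW ENTROPY STEP WITH A RATE ON MESOSCOPIC WINDOWS (size XL, load-bearing; the research
residue, re-typed in cycle 2).** There is a packing threshold `ηw > 0` with `CappedWindowEntropyStepMesoBelow ηw`
(`Theorems/SpeedCapSurgeryCappedEulerLimitMeso.lean` §1): in the frame of the crux, for every `t ∈ [0,T)` and cap `C` there are
`K ≥ 0`, a rate `a > 0`, windows `w_N > 0`, `w_N → 0`, and `N₀` with, for `N ≥ N₀` and every window `[s, s+w'] ⊆ [0,t]` of
MESOSCOPIC length `w_N ≤ w' ≤ 2w_N`: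
`H_N(s+w') ≤ (1 + K·√log(N+2)·w')·H_N(s) + w'·(N+1)^{1-a}`,
`H_N(r) := (KL((Φ_N,r)_*(λ_N|cap_{t,C}) ‖ localGibbsLaw σ (thermoActivity σ (ρ r)) (u r) (θ r) N Φ_N)).toReal`.
Why plausibly true: it is Nachtergaele–Yau's `H' ≤ δ⁻¹M(H + N·ω)` on the cap event (cut-off `M = C√log(N+2)` EXACT on the support,
no Chebyshev term; constant LINEAR in `M`, §5 Lemma 5.1; entropy inequality at tilt `γ_N = δ/M_N`) integrated over ONE mesoscopic
window (the prover picks `w_N`, e.g. `τ(N+1)^{-1/3}`, the kinetic window of the sub-problem's docks), with the one-block replacement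
error carrying a RATE `ω_N ≤ N^{-a}` (relative entropy of a smooth-Euler state vs local Gibbs is expected `O(N ε_N²)`, so a
polynomial rate is the natural conjecture); the time-zero entropy is `≤ 1` and the Gronwall factor `e^{K√log(N+2) t}` loses against
any polynomial rate (landed). Why it might fail: (a) the one-block / local-equilibrium step for the DETERMINISTIC dynamics is
Boltzmann-hypothesis-class — nothing in print without noise, and with noise only rate-free (OVY 1993 via limit states); (b) the cap
discharges none of the true-law a-priori inputs of the sibling dock at fixed thresholds, so the step needs reference-law LD inputs
WITH RATES and polylog(N) growth constants (not filed); (c) a hidden `e^{cM²}` in the large deviations of the capped currents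
(OVY 1993 §3 Lemmas 3.7–3.8) would force `a > c'`. Leans on: `cappedLaw`, `RefConcentrates` (hypothesis), `IsHardSphereEulerSolution`,
`hsPressure`, Mathlib `InformationTheory.klDiv`, `HardSphereFlow.lawAt`; un-filed inputs KCWF-R / LCT-R (NOTES.md §What is missing).
[cite: NachtergaeleYau2003, §5 Lemma 5.1 and §7.2] [cite: OllaVaradhanYau1993, §3 and §5 Thm 5.1] [cite: Yau1991, §2–3] -/
theorem stub_cappedWindowStepMeso : ∃ ηw : ℝ, 0 < ηw ∧ CappedWindowEntropyStepMesoBelow ηw := by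
  sorry

/-! ## The crux BY NAME (real proof; `sorry` only inside the declared stub) -/

/-- **The skeleton theorem, v3 (cycle 2).** The landed conditional reduction `CappedEulerLimit_of_cappedWindowStepMeso`
(Theorems/SpeedCapSurgeryCappedEulerLimitMeso.lean) applied to the open stub: closing `stub_cappedWindowStepMeso` closes the crux.
(Independently, the landed `CappedEulerLimit_of_relEntropyVanishingInBand` / `_of_hydroLimitInBand` /  `_of_signedInputs` of part III
close it from the conjunct's entropy target — the dominated closure, no cap used.) [folklore] -/
theorem CappedEulerLimit_proof :
    Summit.AtomisticToContinuum.HydrodynamicLimit.Theses.SpeedCapSurgery.CappedEulerLimit :=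
  CappedEulerLimit_of_cappedWindowStepMeso stub_cappedWindowStepMeso

end Summit.AtomisticToContinuum.HydrodynamicLimit.Theorems.CappedEulerLimit

end
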